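import Summits.BirchSwinnertonDyer.Rank1Residual.X12.O11.RamifiedStrictDescentAtThreeRegimeVDischarge
import HarnessLib

/-!
# O11 at `p = 3`, companion VII — REGIME T of route `PrintCFram` (item stmt-BirchSwinnertonDyer-20699):
# TORSION-ALLOWING control with BOTH defects displayed — `#Sel^γ · d₀ = #Sel_𝔭(K, W[3^∞]) · d({𝔭} ∪ T₀)`,
# PROVED without (A𝔭)₃ — and the three regime-T inputs (R-tors)₃ᵀ, (R-ctrl)₃ᵀ♯, (R-EU)₃ᵀ typed with
# mod-torsion levels `ñ, ñ'` (cell `bsd-print-cfram`, D-0131 (2), typer `ty2` gen 3; PLAN v5 ask (δ)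
# «T package — type now: control with both defects displayed as a THEOREM; torsion-allowing carriers»;
# NOTHING about BSD asserted)

HONEST FRAMING (cell `bsd-print-cfram`, HOME `run/shared/lean/pub/bsd-print-cfram/`): ONE real
definition (the displayed global defect `globalControlDefectAtThree`, a natural number) and THEOREMS;
no named fact, no axiom, no `sorry`, nothing about BSD; regime T and the leaf stay OPEN; beyond-print
theorem: NO (Greenberg-type control bookkeeping on the tree's objects).

SETTING. Regime T of the route split = the `3`-frames `(K, 𝔭, W', C)` (`K = ℚ(√−3)`, `𝔭 = (√−3)`) at
which (A𝔭)₃ FAILS: `W` or `W' = W^{(−3)}` has a non-zero `ℚ₃`-rational `3`-torsion point (474/919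
classes `N < 5·10⁵`, ty3 PART F). Then `W_K(K_𝔭)[3] ≠ 0`, Greenberg's local kernel `ker r_𝔭` need not
vanish and `res : H¹(K, W[3^∞]) → H¹(K_∞, W[3^∞])` need not be injective — the two places where
companions V/VI used (A𝔭)₃. This file removes (A𝔭)₃ from the CONTROL THEOREM by DISPLAYING both
defects instead of killing them:
* `d({𝔭} ∪ T₀) := controlDefectAtThree W K 𝔭 κ T₀` (companion VI, unchanged: the order of the image of
  `A = res⁻¹(Sel_𝔭(K_∞, W[3^∞]))` under `loc_{{𝔭} ∪ T₀}`; its `𝔭`-component is now NOT trivial —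
  it lies in `ker r_𝔭`, of order `≤ #H¹(Γ_𝔭, W(K_{∞,𝔭})[3^∞])`, `= #W_K(K_𝔭)[3^∞]` when that module is
  finite — DISPLAYED, never evaluated);
* `d₀ := globalControlDefectAtThree W K κ` (§1, NEW: the order of `ker(res) = H¹(Γ, W(K_∞)[3^∞])`
  (inflation–restriction), `= #W(K)[3^∞]` when `W(K^ac_∞)[3^∞]` is finite (Herbrand quotient of a
  finite module; `= 1` on regimes N, V, T_split, `3` or `9` on T_cube — reader's lemma, PLAN v5 (δ),
  values = ty3 PART H) — DISPLAYED, never evaluated).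

* §2 (generic: any `E` over a totally complex `K`, any `p`, `κ` with generator `γ`, `𝔭`, `Σ`, finite
  `T ∋ 𝔭`): `natCard_invariants_mul_natCard_ker_eq_mul_natCard_range` — companion V's
  `natCard_invariants_eq_natCard_selmerAcBase_mul_natCard_range` WITHOUT its injectivity hypothesis
  `hinj`: `#Sel^γ · #ker(res) = #Sel_𝔭^Σ(K, E[p^∞]) · #im(ψ_T|_A)` and `#im(ψ_T|_A) ≤ ∏_{v ∈ T} #ker r_v`
  (`res : A ↠ Sel^γ` by Lemma 3.2 with kernel `ker(res) ⊆ A`; `ker(ψ_T|_A) = Sel_𝔭^Σ(K)`; first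
  isomorphism theorem twice). Finiteness of `ker r_v` at EVERY `v ∈ T` (now including `𝔭`) and of
  `Sel_𝔭^Σ(K)` are the hypotheses; finiteness of `Sel^γ`, of `A` and of `ker(res)` are CONCLUSIONS.
* §3 at a `3`-frame WITHOUT (A𝔭)₃: `natCard_invariants_mul_globalDefect_eq_mul_defect_of_isFrameThree`
  — `#Sel^γ · d₀ = #Sel_𝔭(K, W[3^∞]) · d(T₀)` and `d(T₀) ≤ #ker r_𝔭 · 3^{Σ_{v ∈ T₀} ord₃ c_v(W_K)}`,
  under ONE local finiteness binder `Finite (ker r_𝔭)` (p3 discharges it: `W(K_{∞,𝔭})[3^∞]` finite)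
  and (Av)₃ off `T₀`; with (D♮)₃: `#Sel^γ · d₀ = #Sel_str(W)[3^∞] · #Sel_str(W')[3^∞] · d(T₀)`.
The SEQUELS (≤ 400-line rule) carry: the three regime-T inputs typed WITHOUT (A𝔭)₃ and with the
generators' `3`-divisibility levels in `W(ℚ₃)`, `W'(ℚ₃)` taken MODULO TORSION (`ñ`, `ñ'`: the strict
Kummer condition at `3` reads `loc(aP) ∈ 3^N W(ℚ₃) + W(ℚ₃)_tors`) — (R-tors)₃ᵀ, (R-ctrl)₃ᵀ♯
«`n₀ + log₃ #X[T] + log₃ d₀ = log₃ #Sel_str(W) + log₃ #Sel_str(W') + log₃ d(T₀)`» (PROVED from §3),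
(R-EU)₃ᵀ «`n₀ + log₃ #X[T] + log₃ d₀ = ñ + ñ' + ord₃ #Ш_an(W) + ord₃ #Ш_an(W') + log₃ d(T₀)`» (the
regime-T residual; NOT in print; on N ∪ V frames `d₀ = 1`, `ñ = n` and it is (R-EU)₃ᵛ) —, the
torsion-modded index theorem `#Sel_str(W)[3^∞] = 3^ñ · #Ш(W)[3^∞]`, and the consumer `⟹ BSD(W, 3)`.

References: [GreenbergLNM1716] §3 Lemmas 3.1–3.3 (pp. 85–87), p. 90, §4 Lemma 4.2, Prop. 4.13;
[JetchevSkinnerWan2017] §3.3, Prop. 3.3.7 (shape: the finite local factor at 𝔭); [Castella2018] Def. 2.2,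
Thm. 2.3 (shape); [PerrinRiou1993AIF] §3.3.4–3.3.5; [GrossZagier1986] Thm. I.(7.3); [MilneADT2006]
Thm. I.4.10; tree: companions V/VI/VI-b (`RamifiedStrictDescentAtThree{Defect,RegimeV,RegimeVDischarge}`),
X11b `BDPRouteControlSnake/StrictPlace`, `AnticyclotomicControlMap`; HOME/PLAN.md v5 (δ); HOME/DOSSIER.md §26, §37.
-/

noncomputable section

open scoped Classical

open WeierstrassCurve NumberField IsDedekindDomain Field PowerSeries
  Literature.NumberTheory.EllipticCurves
  Literature.NumberTheory.EllipticCurves.GreenbergSelmer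
  Literature.NumberTheory.EllipticCurves.Rank1Residual
  Literature.NumberTheory.GaloisRepresentations
  Summit.BirchSwinnertonDyer.Rank1Residual
  Summit.BirchSwinnertonDyer.Rank1Residual.Additive
  Summit.BirchSwinnertonDyer.Rank1Residual.X11b
  Summit.BirchSwinnertonDyer.Rank1Residual.X11b.AcSelmer
  Summit.BirchSwinnertonDyer.BirchSwinnertonDyer.Theorems

namespace Summit.BirchSwinnertonDyer.Rank1Residual.X12.O11

/-! ## §1 The displayed global defect `d₀ = #ker(res)` -/

section GlobalDefect

variable (W : WeierstrassCurve ℚ) (K : Type) [Field K] [NumberField K] (κ : ZpExtension K 3)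

/-- **The global control defect `d₀` at `3`** (a natural number): the order of the kernel of the
restriction `res : H¹(K, W[3^∞]) → H¹(K_∞, W[3^∞])` along the `ℤ₃`-extension `κ` (`W.resOfLe` from
`⊤` to `ker κ`), i.e. of `H¹(Γ, W(K_∞)[3^∞])` by inflation–restriction. When `W(K_∞)[3^∞]` is finite
(CM with `3 ∣ d_K`: `Gal(K(W[3^∞])/K_∞^ac)` is infinite inside `𝒪_𝔭^×`, so the fixed module is some
`W[𝔭^m]`) the Herbrand quotient gives `d₀ = #W(K_∞)[3^∞]^Γ = #W(K)[3^∞]` — `1` unless `W` has a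
`K`-rational point of order `3` (regime T_cube: `3` or `9`); DISPLAYED here as a number, never
evaluated or bound (`Nat.card` of an infinite group would read `0`; §2 proves it finite whenever
`Sel_𝔭(K, W[3^∞])` and the local kernels are). Under (A𝔭)₃ `res` is injective and `d₀ = 1`
(companion V). [cite: GreenbergLNM1716, §3 Lemma 3.1 (p. 85: `ker h_n = H¹(Γ_n, E(F_∞)[p^∞])`) and Lemma 3.2]
[cite: JetchevSkinnerWan2017, §3.3 Prop. 3.3.7 (the finite global/local factors; shape only)] -/
def globalControlDefectAtThree : ℕ :=
  Nat.card ((W.baseChange K).resOfLe 3 (le_top : κ.kerSubgroup ≤ ⊤)).ker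

/-- Unfolding `globalControlDefectAtThree`. [folklore] -/
theorem globalControlDefectAtThree_def :
    globalControlDefectAtThree W K κ =
      Nat.card ((W.baseChange K).resOfLe 3 (le_top : κ.kerSubgroup ≤ ⊤)).ker :=
  rfl

end GlobalDefect

/-! ## §2 Generic: control with the global AND the local defects displayed (no injectivity) -/

section Generic

variable {K : Type} [Field K] [NumberField K]
variable {E : WeierstrassCurve K} {p : ℕ} [Fact p.Prime] {κ : ZpExtension K p}
  {𝔭 : HeightOneSpectrum (𝓞 K)} {S : Set (HeightOneSpectrum (𝓞 K))}

/-- **Control with BOTH defects displayed (Greenberg §3, torsion allowed).** For `E` over a totally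
complex `K`, `κ` with topological generator `γ`, `𝔭`, `Σ`, a finite set `T ∋ 𝔭` of finite places (all
`∉ Σ`, apart from `𝔭` not above `p`) off which the away conditions descend, `ker r_v` finite at EVERY
`v ∈ T` (including `𝔭`) and `Sel_𝔭^Σ(K, E[p^∞])` finite: then `Sel^γ`, `A = res⁻¹(Sel_𝔭^Σ(K_∞, E[p^∞]))`
and `ker(res)` are finite,
`#Sel^γ · #ker(res) = #Sel_𝔭^Σ(K, E[p^∞]) · #im(ψ_T|_A)` and `#im(ψ_T|_A) ≤ ∏_{v ∈ T} #ker r_v`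
(`ψ_T = loc_T`). Companion V's `natCard_invariants_eq_natCard_selmerAcBase_mul_natCard_range` WITHOUT
`hinj`: `res : A → Sel^γ` is onto (Lemma 3.2) with kernel `ker(res)` (`⊆ A` since `0 ∈ Sel(K_∞)`),
`ker(ψ_T|_A) = Sel_𝔭^Σ(K)` exactly, `im(ψ_T|_A) ⊆ ⊕_{v ∈ T} ker r_v`; two first-isomorphism counts of `#A`.
[cite: GreenbergLNM1716, §3 Lemmas 3.1–3.2 (pp. 85–86), p. 90 and §4 Lemma 4.7, Prop. 4.13]
[cite: JetchevSkinnerWan2017, §3.3 and Thm. 3.3.1 (control; shape only)] -/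
theorem natCard_invariants_mul_natCard_ker_eq_mul_natCard_range [IsTotallyComplex K]
    {γ : absoluteGaloisGroup K} (hγ : κ.IsTopGenerator γ)
    (T : Finset (HeightOneSpectrum (𝓞 K))) (h𝔭T : 𝔭 ∈ T)
    (hTp : ∀ v ∈ T, v ≠ 𝔭 → ((p : ℕ) : 𝓞 K) ∉ v.asIdeal) (hTS : ∀ v ∈ T, v ∉ S)
    (hS : ∀ c : E.subgroupH1 p (⊤ : Subgroup (absoluteGaloisGroup K)),
      E.resOfLe p (le_top : κ.kerSubgroup ≤ ⊤) c ∈ selmerAc E p κ 𝔭 S →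
        ∀ v : HeightOneSpectrum (𝓞 K), ((p : ℕ) : 𝓞 K) ∉ v.asIdeal → v ∉ S → v ∉ T →
          c ∈ awayKer ⊤ (E.geomPrimaryTorsion p) v)
    [Finite (selmerAcBase E p 𝔭 S)]
    (hfin : ∀ v ∈ T, Finite (localKer κ.kerSubgroup (E.geomPrimaryTorsion p) v)) :
    Finite (IwasawaDual.endInvariants (conjSelmerAc E p κ 𝔭 S γ - 1)) ∧
      Finite (E.resOfLe p (le_top : κ.kerSubgroup ≤ ⊤)).ker ∧
      Nat.card (IwasawaDual.endInvariants (conjSelmerAc E p κ 𝔭 S γ - 1)) *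
          Nat.card (E.resOfLe p (le_top : κ.kerSubgroup ≤ ⊤)).ker =
        Nat.card (selmerAcBase E p 𝔭 S) *
          Nat.card ((locAtFinset E p T).comp (selmerAcPreimage E p κ 𝔭 S).subtype).range ∧
      Nat.card ((locAtFinset E p T).comp (selmerAcPreimage E p κ 𝔭 S).subtype).range ≤
        ∏ v ∈ T, Nat.card (localKer κ.kerSubgroup (E.geomPrimaryTorsion p) v) := by
  set A := selmerAcPreimage E p κ 𝔭 S
  set ψ : A →+ Π v : T, subgroupH1 ((⊤ : Subgroup (absoluteGaloisGroup K)) ⊓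
      decomp (v : HeightOneSpectrum (𝓞 K))) (E.geomPrimaryTorsion p) :=
    (locAtFinset E p T).comp A.subtype with hψ
  -- (1) the image lies in `∏ ker r_v`
  have hrange : ∀ (a : A) (v : T), ψ a v ∈ localKer κ.kerSubgroup (E.geomPrimaryTorsion p) v :=
    fun a v ↦ resOfLe_mem_localKer_of_mem_selmerAcPreimage_strict hTp hTS a.2 v
  -- (2) the kernel is `Sel_𝔭^Σ(K, E[p^∞])`
  have hker : ∀ a : A, a ∈ ψ.ker ↔ (a : E.subgroupH1 p ⊤) ∈ selmerAcBase E p 𝔭 S := by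
    intro a
    rw [AddMonoidHom.mem_ker, mem_selmerAcBase_iff_locAtFinset_eq_zero_strict h𝔭T hTp hTS hS a.2]
    rfl
  -- (3) finiteness and count of `im ψ`
  haveI hfinT : ∀ v : T, Finite (localKer κ.kerSubgroup (E.geomPrimaryTorsion p)
      (v : HeightOneSpectrum (𝓞 K))) := fun v ↦ hfin v v.2
  let e : ψ.range → Π v : T, localKer κ.kerSubgroup (E.geomPrimaryTorsion p)
      (v : HeightOneSpectrum (𝓞 K)) :=
    fun y ↦ fun v ↦ ⟨y.1 v, by
      obtain ⟨a, ha⟩ := y.2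
      rw [← ha]
      exact hrange a v⟩
  have he : Function.Injective e := by
    intro y₁ y₂ h
    apply Subtype.ext
    funext v
    simpa [e] using congrArg Subtype.val (congr_fun h v)
  haveI : Finite ψ.range := Finite.of_injective e he
  have hcard_range : Nat.card ψ.range ≤
      ∏ v ∈ T, Nat.card (localKer κ.kerSubgroup (E.geomPrimaryTorsion p) v) := by
    calc Nat.card ψ.range
        ≤ Nat.card (Π v : T, localKer κ.kerSubgroup (E.geomPrimaryTorsion p)
            (v : HeightOneSpectrum (𝓞 K))) := Nat.card_le_card_of_injective e he
      _ = ∏ v : T, Nat.card (localKer κ.kerSubgroup (E.geomPrimaryTorsion p)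
            (v : HeightOneSpectrum (𝓞 K))) := Nat.card_pi
      _ = ∏ v ∈ T, Nat.card (localKer κ.kerSubgroup (E.geomPrimaryTorsion p) v) :=
          Finset.prod_coe_sort T fun v ↦
            Nat.card (localKer κ.kerSubgroup (E.geomPrimaryTorsion p) v)
  -- (4) `ker ψ ≃ Sel_𝔭^Σ(K, E[p^∞])`, exactly
  let f : ψ.ker → selmerAcBase E p 𝔭 S := fun a ↦ ⟨((a : A) : E.subgroupH1 p ⊤), (hker a).mp a.2⟩
  have hf : Function.Bijective f := by
    refine ⟨fun a₁ a₂ h ↦ ?_, fun b ↦ ?_⟩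
    · apply Subtype.ext; apply Subtype.ext
      simpa [f] using congrArg (fun x : selmerAcBase E p 𝔭 S ↦ (x : E.subgroupH1 p ⊤)) h
    · refine ⟨⟨⟨(b : E.subgroupH1 p ⊤), selmerAcBase_le_selmerAcPreimage b.2⟩, (hker _).mpr b.2⟩, ?_⟩
      rfl
  haveI : Finite ψ.ker := Finite.of_injective f hf.1
  have hcard_ker : Nat.card ψ.ker = Nat.card (selmerAcBase E p 𝔭 S) :=
    Nat.card_congr (Equiv.ofBijective f hf)
  -- (5) `A` is finite and `#A = #Sel(K) · #im ψ`
  haveI : Finite (A ⧸ ψ.ker) :=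
    Finite.of_equiv _ (QuotientAddGroup.quotientKerEquivRange ψ).toEquiv.symm
  haveI hAfin : Finite A :=
    Finite.of_equiv _ (AddSubgroup.addGroupEquivQuotientProdAddSubgroup (s := ψ.ker)).symm
  have hcardA : Nat.card A = Nat.card (selmerAcBase E p 𝔭 S) * Nat.card ψ.range := by
    rw [AddSubgroup.card_eq_card_quotient_mul_card_addSubgroup ψ.ker,
      Nat.card_congr (QuotientAddGroup.quotientKerEquivRange ψ).toEquiv, mul_comm, hcard_ker]
  -- (6) `res : A ↠ Sel^γ` is a surjective homomorphism whose kernel is `ker(res)`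
  set ρ := E.resOfLe p (le_top : κ.kerSubgroup ≤ ⊤) with hρ
  have hmemγ : ∀ a : A, (⟨ρ (a : E.subgroupH1 p ⊤), (mem_selmerAcPreimage_iff _).mp a.2⟩ :
      selmerAc E p κ 𝔭 S) ∈ IwasawaDual.endInvariants (conjSelmerAc E p κ 𝔭 S γ - 1) := fun a ↦ by
    rw [IwasawaDual.mem_endInvariants_iff, IwasawaDual.End_sub_apply, AddMonoid.End.one_apply,
      sub_eq_zero]
    exact Subtype.ext (conjH1_resOfLe_top γ (a : E.subgroupH1 p ⊤))
  let g : A →+ IwasawaDual.endInvariants (conjSelmerAc E p κ 𝔭 S γ - 1) :=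
    { toFun := fun a ↦ ⟨⟨ρ (a : E.subgroupH1 p ⊤), (mem_selmerAcPreimage_iff _).mp a.2⟩, hmemγ a⟩
      map_zero' := by
        apply Subtype.ext; apply Subtype.ext
        show ρ ((0 : A) : E.subgroupH1 p ⊤) = 0
        rw [AddSubgroup.coe_zero, map_zero]
      map_add' := fun a b ↦ by
        apply Subtype.ext; apply Subtype.ext
        show ρ ((a + b : A) : E.subgroupH1 p ⊤) = ρ (a : E.subgroupH1 p ⊤) + ρ (b : E.subgroupH1 p ⊤)
        rw [AddSubgroup.coe_add, map_add] }
  have hg_apply : ∀ a : A, ((g a : selmerAc E p κ 𝔭 S) : E.subgroupH1 p κ.kerSubgroup) =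
      ρ (a : E.subgroupH1 p ⊤) := fun _ ↦ rfl
  have hg_surj : Function.Surjective g := fun x ↦ by
    obtain ⟨c, hcA, hc⟩ := exists_mem_selmerAcPreimage_resOfLe_eq hγ x
    exact ⟨⟨c, hcA⟩, Subtype.ext (Subtype.ext hc)⟩
  -- `ker g ≃ ker(res)` (`ker(res) ⊆ A`)
  have hkerA : ∀ c : E.subgroupH1 p ⊤, c ∈ ρ.ker → c ∈ A := fun c hc ↦ by
    rw [AddMonoidHom.mem_ker] at hc
    exact (mem_selmerAcPreimage_iff c).mpr (by rw [← hρ, hc]; exact zero_mem _)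
  have hmem_gker : ∀ a : A, a ∈ g.ker ↔ (a : E.subgroupH1 p ⊤) ∈ ρ.ker := fun a ↦ by
    rw [AddMonoidHom.mem_ker, AddMonoidHom.mem_ker, ← hg_apply]
    constructor
    · intro h; rw [h]; rfl
    · intro h; exact Subtype.ext (Subtype.ext h)
  let k : ρ.ker → g.ker := fun c ↦ ⟨⟨(c : E.subgroupH1 p ⊤), hkerA c c.2⟩, (hmem_gker _).mpr c.2⟩
  have hk : Function.Bijective k := by
    refine ⟨fun c₁ c₂ h ↦ ?_, fun a ↦ ?_⟩
    · apply Subtype.ext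
      simpa [k] using congrArg (fun x : g.ker ↦ ((x : A) : E.subgroupH1 p ⊤)) h
    · exact ⟨⟨((a : A) : E.subgroupH1 p ⊤), (hmem_gker _).mp a.2⟩, rfl⟩
  have hcard_gker : Nat.card g.ker = Nat.card ρ.ker := (Nat.card_congr (Equiv.ofBijective k hk)).symm
  -- (7) counts: `#A = #Sel^γ · #ker(res)`
  have hcardA' : Nat.card A =
      Nat.card (IwasawaDual.endInvariants (conjSelmerAc E p κ 𝔭 S γ - 1)) * Nat.card ρ.ker := by
    rw [AddSubgroup.card_eq_card_quotient_mul_card_addSubgroup g.ker,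
      Nat.card_congr (QuotientAddGroup.quotientKerEquivOfSurjective g hg_surj).toEquiv, hcard_gker]
  refine ⟨Finite.of_surjective g hg_surj, ?_, by rw [← hcardA', hcardA], hcard_range⟩
  haveI : Finite g.ker := inferInstance
  exact Finite.of_equiv _ (Equiv.ofBijective k hk).symm

end Generic

/-! ## §3 At a `3`-frame WITHOUT (A𝔭)₃: both defects displayed, (Av)₃ only off `T₀` -/

section FrameThreeT

variable {W : WeierstrassCurve ℚ} [W.IsElliptic] {K : Type} [Field K] [NumberField K]
  {𝔭 : HeightOneSpectrum (𝓞 K)} {W' : WeierstrassCurve ℚ} {C : VariableChange ℚ}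

/-- **TORSION-ALLOWING control at a `3`-frame (regimes N ∪ V ∪ T).** At a `3`-frame `(K, 𝔭, W', C)` of
`W`, for every anticyclotomic `ℤ₃`-extension `κ` with topological generator `γ`, granted a finite set
`T₀` of places `v ∤ 3` such that (Av)₃ holds at every degree-one `v ∤ 3` OUTSIDE `T₀`, FINITENESS of
`ker r_𝔭 = ker(H¹(K_𝔭, W[3^∞]) → H¹(K_{∞,𝔭}, W[3^∞]))` (`hfin𝔭`; under (A𝔭)₃ it is trivial, companion
V; in general `= #W_K(K_𝔭)[3^∞]` when `W(K_{∞,𝔭})[3^∞]` is finite — p3's discharge) and finiteness of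
`Sel_𝔭(K, W[3^∞])`: then `Sel^γ` and `ker(res)` are finite,
`#Sel^γ · d₀ = #Sel_𝔭(K, W[3^∞]) · d(T₀)` and `d(T₀) ≤ #ker r_𝔭 · 3^{Σ_{v ∈ T₀} ord₃ c_v(W_K)}`
(`d₀ = globalControlDefectAtThree`, `d = controlDefectAtThree`). §2 with `T = {𝔭} ∪ T₀`; away
descent off `T` by companion IV's trichotomy (inert / ramified places automatic for anticyclotomic `κ`,
degree-one places from `hv`); Greenberg's Lemma 3.3 on `T₀`. NO (A𝔭)₃.
[cite: GreenbergLNM1716, §3 Lemmas 3.1–3.3 (pp. 85–87), p. 90, §4 Prop. 4.13]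
[cite: JetchevSkinnerWan2017, §3.3 Prop. 3.3.7 (the finite factors at 𝔭; shape only)] -/
theorem natCard_invariants_mul_globalDefect_eq_mul_defect_of_isFrameThree (hF : IsFrameThree W K 𝔭 W' C)
    (κ : ZpExtension K 3) (hκ : κ.IsAnticyclotomic) (γ : absoluteGaloisGroup K)
    [hγ : Fact (κ.IsTopGenerator γ)]
    (hfin𝔭 : Finite (localKer κ.kerSubgroup ((W.baseChange K).geomPrimaryTorsion 3) 𝔭))
    (T₀ : Finset (HeightOneSpectrum (𝓞 K))) (hT₀ : ∀ v ∈ T₀, ((3 : ℕ) : 𝓞 K) ∉ v.asIdeal)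
    (hv : ∀ v : HeightOneSpectrum (𝓞 K), v ∉ T₀ → ((3 : ℕ) : 𝓞 K) ∉ v.asIdeal →
      v.asIdeal.ramificationIdx (𝓞 ℚ) = 1 → v.asIdeal.inertiaDeg (𝓞 ℚ) = 1 →
      (W.baseChange K).HasGoodReductionAt v ∨
        ∀ R : ((W.baseChange K).baseChange (v.adicCompletion K)).toAffine.Point,
          (3 : ℕ) • R = 0 → R = 0)
    [Finite (selmerAcBase (W.baseChange K) 3 𝔭 ∅)] :
    Finite (IwasawaDual.endInvariants
        (Castella2018.AcSelmer.conjSelmerAc (W.baseChange K) 3 κ 𝔭 ∅ γ - 1)) ∧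
      Finite ((W.baseChange K).resOfLe 3 (le_top : κ.kerSubgroup ≤ ⊤)).ker ∧
      Nat.card (IwasawaDual.endInvariants
          (Castella2018.AcSelmer.conjSelmerAc (W.baseChange K) 3 κ 𝔭 ∅ γ - 1)) *
          globalControlDefectAtThree W K κ =
        Nat.card (selmerAcBase (W.baseChange K) 3 𝔭 ∅) * controlDefectAtThree W K 𝔭 κ T₀ ∧
      controlDefectAtThree W K 𝔭 κ T₀ ≤
        Nat.card (localKer κ.kerSubgroup ((W.baseChange K).geomPrimaryTorsion 3) 𝔭) *
          3 ^ (∑ v ∈ T₀, padicValNat 3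
            (((W.baseChange K).baseChange (v.adicCompletion K)).localTamagawaNumber
              (v.adicCompletionIntegers K))) := by
  haveI : IsTotallyComplex K := hF.2.2.1.2
  haveI hEK : (W.baseChange K).IsElliptic := by rw [baseChange]; infer_instance
  have hK2 : Module.finrank ℚ K = 2 := hF.2.2.1.1
  have h3𝔭 : ((3 : ℕ) : 𝓞 K) ∈ 𝔭.asIdeal := hF.2.2.2.2.1
  have h𝔭T₀ : 𝔭 ∉ T₀ := fun h => hT₀ 𝔭 h h3𝔭
  -- away descent off `{𝔭} ∪ T₀`, pointwise (companion IV's trichotomy argument)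
  have hS : ∀ c : (W.baseChange K).subgroupH1 3 (⊤ : Subgroup (absoluteGaloisGroup K)),
      (W.baseChange K).resOfLe 3 (le_top : κ.kerSubgroup ≤ ⊤) c ∈
          selmerAc (W.baseChange K) 3 κ 𝔭 ∅ →
        ∀ v : HeightOneSpectrum (𝓞 K), ((3 : ℕ) : 𝓞 K) ∉ v.asIdeal → v ∉ (∅ : Set _) →
          v ∉ insert 𝔭 T₀ → c ∈ awayKer ⊤ ((W.baseChange K).geomPrimaryTorsion 3) v := by
    intro c hc v hpv hvS hvT
    have hvT₀ : v ∉ T₀ := fun h => hvT (Finset.mem_insert_of_mem h)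
    have h1 := ((mem_selmerOver_iff _).mp hc).1 v hpv hvS 1
    rw [Literature.NumberTheory.EllipticCurves.conjH1_one_holds, AddMonoidHom.id_apply] at h1
    set v₀ : HeightOneSpectrum (𝓞 ℚ) := v.under (𝓞 ℚ) with hv₀def
    rcases placesOver_trichotomy_of_finrank_eq_two K hK2 v₀ with
        ⟨w₁, w₂, -, -, hef⟩ | ⟨w, hset, -, hf⟩ | ⟨w, hset, he, -⟩
    · obtain ⟨he, hf⟩ := hef v rfl
      rcases hv v hvT₀ hpv he hf with hgood | htors
      · exact (resOfLe_mem_awayKer_kerSubgroup_iff_of_hasGoodReductionAt (W.baseChange K) 3 κ hpv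
          hgood c).mp h1
      · exact mem_awayKer_of_localKer_eq_bot hpv hvS
          (AcSelmer.localKer_eq_bot_of_noPTorsion (W.baseChange K) 3 κ v htors) hc
    · have hvw : v = w := by
        have hmem : v ∈ {w' : HeightOneSpectrum (𝓞 K) | w'.under (𝓞 ℚ) = v₀} := rfl
        rw [hset] at hmem
        exact hmem
      have hf' : v.asIdeal.inertiaDeg (𝓞 ℚ) = 2 := by rw [hvw]; exact hf
      exact (IsAnticyclotomic.resOfLe_mem_awayKer_iff_of_inertiaDeg_eq_two hK2 hκ hpv
        (ℓ := v₀) rfl hf' c).mp h1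
    · have hvw : v = w := by
        have hmem : v ∈ {w' : HeightOneSpectrum (𝓞 K) | w'.under (𝓞 ℚ) = v₀} := rfl
        rw [hset] at hmem
        exact hmem
      have he' : v.asIdeal.ramificationIdx (𝓞 ℚ) = 2 := by rw [hvw]; exact he
      exact (IsAnticyclotomic.resOfLe_mem_awayKer_iff_of_ramificationIdx_eq_two hK2 hκ hpv he'
        c).mp h1
  obtain ⟨hfin, hfinker, heq, hle⟩ := natCard_invariants_mul_natCard_ker_eq_mul_natCard_range
    (E := W.baseChange K) (S := (∅ : Set (HeightOneSpectrum (𝓞 K)))) hγ.out (insert 𝔭 T₀)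
    (Finset.mem_insert_self 𝔭 T₀)
    (fun v hvT hne => hT₀ v ((Finset.mem_insert.mp hvT).resolve_left hne))
    (fun v _ => Set.notMem_empty v) hS
    (fun v hvT => by
      rcases Finset.mem_insert.mp hvT with rfl | hvT₀
      · exact hfin𝔭
      · exact (natCard_localKer_le_pow_padicValNat_localTamagawaNumber (W.baseChange K) κ
          (hT₀ v hvT₀)).1)
  refine ⟨hfin, hfinker, ?_, ?_⟩
  · rw [globalControlDefectAtThree_def, controlDefectAtThree_def]; exact heq
  · rw [controlDefectAtThree_def]
    refine hle.trans ?_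
    rw [Finset.prod_insert h𝔭T₀, ← Finset.prod_pow_eq_pow_sum]
    exact Nat.mul_le_mul_left _ (Finset.prod_le_prod' fun v hvT₀ =>
      (natCard_localKer_le_pow_padicValNat_localTamagawaNumber (W.baseChange K) κ (hT₀ v hvT₀)).2)

/-- **`#Sel^γ · d₀ = #Sel_str(W/ℚ)[3^∞] · #Sel_str(W'/ℚ)[3^∞] · d(T₀)`** at a `3`-frame with globally
minimal twin `W'`, WITHOUT (A𝔭)₃: the previous theorem and the unconditional twist count (D♮)₃
(`natCard_selmerAcBase_frameThree_eq_mul`). The corrected (R-ctrl)₃ᵀ♯ of regime T in cardinality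
form, both defects displayed. [cite: GreenbergLNM1716, §3 Lemma 3.3 (p. 87), p. 90, §4 Prop. 4.13]
[cite: DokchitserDokchitserAnnals2010, Lemma 4.14 (proof) (the twist decomposition)] -/
theorem natCard_invariants_mul_globalDefect_eq_strictSelmer_mul_defect_of_isFrameThree [W'.IsElliptic]
    (hF : IsFrameThree W K 𝔭 W' C)
    (κ : ZpExtension K 3) (hκ : κ.IsAnticyclotomic) (γ : absoluteGaloisGroup K)
    [Fact (κ.IsTopGenerator γ)]
    (hfin𝔭 : Finite (localKer κ.kerSubgroup ((W.baseChange K).geomPrimaryTorsion 3) 𝔭))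
    (T₀ : Finset (HeightOneSpectrum (𝓞 K))) (hT₀ : ∀ v ∈ T₀, ((3 : ℕ) : 𝓞 K) ∉ v.asIdeal)
    (hv : ∀ v : HeightOneSpectrum (𝓞 K), v ∉ T₀ → ((3 : ℕ) : 𝓞 K) ∉ v.asIdeal →
      v.asIdeal.ramificationIdx (𝓞 ℚ) = 1 → v.asIdeal.inertiaDeg (𝓞 ℚ) = 1 →
      (W.baseChange K).HasGoodReductionAt v ∨
        ∀ R : ((W.baseChange K).baseChange (v.adicCompletion K)).toAffine.Point,
          (3 : ℕ) • R = 0 → R = 0)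
    [Finite (selmerAcBase (W.baseChange K) 3 𝔭 ∅)] :
    Finite (IwasawaDual.endInvariants
        (Castella2018.AcSelmer.conjSelmerAc (W.baseChange K) 3 κ 𝔭 ∅ γ - 1)) ∧
      Nat.card (IwasawaDual.endInvariants
          (Castella2018.AcSelmer.conjSelmerAc (W.baseChange K) 3 κ 𝔭 ∅ γ - 1)) *
          globalControlDefectAtThree W K κ =
        Nat.card ↥(strictSelmerPInfty W 3) * Nat.card ↥(strictSelmerPInfty W' 3) *
          controlDefectAtThree W K 𝔭 κ T₀ := by
  rw [← natCard_selmerAcBase_frameThree_eq_mul W hF]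
  obtain ⟨hfin, -, heq, -⟩ := natCard_invariants_mul_globalDefect_eq_mul_defect_of_isFrameThree hF κ
    hκ γ hfin𝔭 T₀ hT₀ hv
  exact ⟨hfin, heq⟩

end FrameThreeT

end Summit.BirchSwinnertonDyer.Rank1Residual.X12.O11

end
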